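import Summits.MatrixMultiplication.OmegaCensus.SmallFormats.InvertiblePointNearFrame
import HarnessLib

/-!
# ω-census family (a): the COMMUTATOR IDENTITY at a near-frame point of `⟨m,m,n⟩` (the two defects paired)

Cell `pub-omega` (unit `pub-omega-tensor`, gen 35), topic `Summits/MatrixMultiplication/OmegaCensus` (sub-folder
`SmallFormats`). Framing (verbatim): lottery ticket; floor = certified bounds/negative ranges. HONEST FRAMING: an elementary exact
identity over an arbitrary field on top of `InvertiblePointNearFrame` (p493611, tensor g25); it is the kernel form of the desk identity
'(III)/(IV)' of tensor g35's NEAR-LAW-g35.md §2 — the main structural handle found so far on the open DEFECT-RANK LEMMA (W-side cost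
≤ 2 of the split, which would turn the near-point law `7n ≤ 2r + 2` of `InvertiblePointNearLaw` into `7n ≤ 2r + 1` and exclude near
points at `⟨2,2,6⟩@20`). Not a rank bound; nothing on `ω`.

**Setting** (`X₀ = 1`, `O` = terms with `f_i(1) ≠ 0`, near-frame data `f_s(1) g_s(W_j) = δ_{sj} + ρ_s σ_j` on `O`,
`near_footprint_w_eq`). Put `c_s := f_s/f_s(1)`, `D(X) := Σ_{s∈O} ρ_s c_s(X) W_s` (the W-side defect) and
`E(X, Y) := Σ_{s∈O} σ_s f_s(X) g_s(Y)` (the K-side defect). Let `Y` be killed by every `g_t`, `t ∉ O` (`Y ∈ K₀`) and let the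
functional `ζ` kill every `W_t`, `t ∉ O` (`ζ ∈ 𝒲'^⊥`). Then for all `X, X'`:
* (`zeta_mul_w`) `ζ(X W_j) = c_j(X) ζ(W_j) + σ_j ζ(D(X))` (`j ∈ O`; `ζ` applied to the near footprint);
* (`zeta_mul_mul_eq`) **`ζ((X X') Y) = Σ_{s∈O} c_s(X) f_s(X') g_s(Y) ζ(W_s) + E(X', Y)·ζ(D(X))`** — computing `ζ(X·(X'Y))` by
  Brent on `K₀` for `X'Y` and the dual footprint for `ζ(X W_s)`;
* (`zeta_commutator_mul`) hence **`ζ([X, X'] Y) = E(X', Y)·ζ(D(X)) − E(X, Y)·ζ(D(X'))`**: the pairing between `𝒲'^⊥` and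
  `sl₂·K₀` is controlled by the two rank-`≤ 3` defects; in particular (`zeta_commutator_mul_eq_zero`) `ζ(T Y) = 0` for every
  commutator `T = [X, X']` as soon as `E(·, Y) = 0` or `ζ(D(·)) = 0` — the saturated-case conclusion `sl₂ K₀ ⊆ 𝒲'` restricted to
  the defect-free parts.
-/

namespace Summit.MatrixMultiplication.OmegaCensus.SmallFormats

open Module Matrix Literature.Computability.AlgebraicComplexity

variable {k : Type*} [Field k] {m n : ℕ} {ι : Type*} [Fintype ι] [DecidableEq ι]

namespace NearFrame

variable (β : BilinComp (mulBilin k m m n) ι) (O : Finset ι)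

/-- **Dual footprint.** For `ζ` killing the outputs of the vanishing terms and `j ∈ O`:
`ζ(X W_j) = c_j(X) ζ(W_j) + σ_j ζ(D(X))`. -/
theorem zeta_mul_w (hO' : ∀ i ∈ O, β.f i 1 ≠ 0) {ρ σ : ι → k}
    (hM : ∀ s ∈ O, ∀ j ∈ O, β.f s 1 * β.g s (β.w j) = (if s = j then 1 else 0) + ρ s * σ j)
    (ζ : Module.Dual k (Matrix (Fin m) (Fin n) k)) (hζ : ∀ t, t ∉ O → ζ (β.w t) = 0) {j : ι} (hj : j ∈ O)
    (X : Matrix (Fin m) (Fin m) k) :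
    ζ (X * β.w j) = β.f j X * (β.f j 1)⁻¹ * ζ (β.w j) +
      σ j * ζ (∑ s ∈ O, (ρ s * (β.f s X * (β.f s 1)⁻¹)) • β.w s) := by
  have h := congrArg ζ (near_footprint_w_eq β O hO' hM hj X)
  have hz : ζ (∑ t ∈ Finset.univ \ O, (β.f t X * β.g t (β.w j)) • β.w t) = 0 := by
    rw [map_sum]
    exact Finset.sum_eq_zero fun t ht => by rw [map_smul, hζ t (Finset.mem_sdiff.mp ht).2, smul_zero]
  rw [hz, map_sub, map_sub, map_smul, map_smul, smul_eq_mul, smul_eq_mul] at h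
  linear_combination h

omit [DecidableEq ι] in
/-- Brent on `K₀`, through `ζ`: `ζ(X Y) = Σ_{s∈O} f_s(X) g_s(Y) ζ(W_s)` for `Y` killed by every `g_t`, `t ∉ O`. -/
theorem zeta_mul_eq_sum (ζ : Module.Dual k (Matrix (Fin m) (Fin n) k)) {Y : Matrix (Fin m) (Fin n) k}
    (hY : ∀ t, t ∉ O → β.g t Y = 0) (X : Matrix (Fin m) (Fin m) k) :
    ζ (X * Y) = ∑ s ∈ O, β.f s X * β.g s Y * ζ (β.w s) := by
  have hB := β.map_eq_sum X Y
  rw [mulBilin_apply] at hB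
  rw [hB, map_sum, ← Finset.sum_subset (Finset.subset_univ O)]
  · exact Finset.sum_congr rfl fun s _ => by rw [map_smul, smul_eq_mul]
  · intro t _ ht
    rw [map_smul, hY t ht, mul_zero, zero_smul]

/-- **The product identity.** For `Y ∈ K₀`, `ζ ∈ 𝒲'^⊥` and all `X, X'`:
`ζ((X X') Y) = Σ_{s∈O} c_s(X) f_s(X') g_s(Y) ζ(W_s) + E(X', Y)·ζ(D(X))`. -/
theorem zeta_mul_mul_eq (hO' : ∀ i ∈ O, β.f i 1 ≠ 0) {ρ σ : ι → k}
    (hM : ∀ s ∈ O, ∀ j ∈ O, β.f s 1 * β.g s (β.w j) = (if s = j then 1 else 0) + ρ s * σ j)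
    (ζ : Module.Dual k (Matrix (Fin m) (Fin n) k)) (hζ : ∀ t, t ∉ O → ζ (β.w t) = 0)
    {Y : Matrix (Fin m) (Fin n) k} (hY : ∀ t, t ∉ O → β.g t Y = 0) (X X' : Matrix (Fin m) (Fin m) k) :
    ζ (X * X' * Y) = ∑ s ∈ O, β.f s X * (β.f s 1)⁻¹ * (β.f s X' * β.g s Y) * ζ (β.w s) +
      (∑ s ∈ O, σ s * (β.f s X' * β.g s Y)) * ζ (∑ s ∈ O, (ρ s * (β.f s X * (β.f s 1)⁻¹)) • β.w s) := by
  -- `X'Y = Σ_s f_s(X') g_s(Y) W_s`, then `ζ(X W_s)` by the dual footprint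
  have hB := β.map_eq_sum X' Y
  rw [mulBilin_apply] at hB
  have hX'Y : X' * Y = ∑ s ∈ O, (β.f s X' * β.g s Y) • β.w s := by
    rw [hB, ← Finset.sum_subset (Finset.subset_univ O)]
    intro t _ ht
    rw [hY t ht, mul_zero, zero_smul]
  rw [Matrix.mul_assoc, hX'Y, Matrix.mul_sum, map_sum]
  simp_rw [Matrix.mul_smul, map_smul, smul_eq_mul]
  rw [Finset.sum_congr rfl fun s hs => by rw [zeta_mul_w β O hO' hM ζ hζ hs X], Finset.sum_mul]
  rw [← Finset.sum_add_distrib]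
  exact Finset.sum_congr rfl fun s _ => by ring

/-- **The commutator identity.** For `Y ∈ K₀`, `ζ ∈ 𝒲'^⊥` and all `X, X'`:
`ζ((X X' − X' X) Y) = E(X', Y)·ζ(D(X)) − E(X, Y)·ζ(D(X'))`. -/
theorem zeta_commutator_mul (hO' : ∀ i ∈ O, β.f i 1 ≠ 0) {ρ σ : ι → k}
    (hM : ∀ s ∈ O, ∀ j ∈ O, β.f s 1 * β.g s (β.w j) = (if s = j then 1 else 0) + ρ s * σ j)
    (ζ : Module.Dual k (Matrix (Fin m) (Fin n) k)) (hζ : ∀ t, t ∉ O → ζ (β.w t) = 0)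
    {Y : Matrix (Fin m) (Fin n) k} (hY : ∀ t, t ∉ O → β.g t Y = 0) (X X' : Matrix (Fin m) (Fin m) k) :
    ζ ((X * X' - X' * X) * Y) =
      (∑ s ∈ O, σ s * (β.f s X' * β.g s Y)) * ζ (∑ s ∈ O, (ρ s * (β.f s X * (β.f s 1)⁻¹)) • β.w s) -
      (∑ s ∈ O, σ s * (β.f s X * β.g s Y)) * ζ (∑ s ∈ O, (ρ s * (β.f s X' * (β.f s 1)⁻¹)) • β.w s) := by
  rw [Matrix.sub_mul, map_sub, zeta_mul_mul_eq β O hO' hM ζ hζ hY X X', zeta_mul_mul_eq β O hO' hM ζ hζ hY X' X]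
  have hsym : ∑ s ∈ O, β.f s X * (β.f s 1)⁻¹ * (β.f s X' * β.g s Y) * ζ (β.w s) =
      ∑ s ∈ O, β.f s X' * (β.f s 1)⁻¹ * (β.f s X * β.g s Y) * ζ (β.w s) :=
    Finset.sum_congr rfl fun s _ => by ring
  rw [hsym]; ring

/-- **Defect-free parts are commutator-orthogonal.** If moreover `E(·, Y) = 0` (i.e. `Y ∈ K₀⁰`) OR `ζ(D(·)) = 0`, then
`ζ(T Y) = 0` for every commutator `T = X X' − X' X` (over a field every trace-zero matrix is a commutator, so this says
`sl_m · Y ⊥ ζ`). -/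
theorem zeta_commutator_mul_eq_zero (hO' : ∀ i ∈ O, β.f i 1 ≠ 0) {ρ σ : ι → k}
    (hM : ∀ s ∈ O, ∀ j ∈ O, β.f s 1 * β.g s (β.w j) = (if s = j then 1 else 0) + ρ s * σ j)
    (ζ : Module.Dual k (Matrix (Fin m) (Fin n) k)) (hζ : ∀ t, t ∉ O → ζ (β.w t) = 0)
    {Y : Matrix (Fin m) (Fin n) k} (hY : ∀ t, t ∉ O → β.g t Y = 0)
    (h0 : (∀ X : Matrix (Fin m) (Fin m) k, ∑ s ∈ O, σ s * (β.f s X * β.g s Y) = 0) ∨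
      (∀ X : Matrix (Fin m) (Fin m) k, ζ (∑ s ∈ O, (ρ s * (β.f s X * (β.f s 1)⁻¹)) • β.w s) = 0))
    (X X' : Matrix (Fin m) (Fin m) k) : ζ ((X * X' - X' * X) * Y) = 0 := by
  rw [zeta_commutator_mul β O hO' hM ζ hζ hY X X']
  rcases h0 with h | h
  · rw [h X, h X']; ring
  · rw [h X, h X']; ring

end NearFrame

end Summit.MatrixMultiplication.OmegaCensus.SmallFormats
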